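import Summits.QuantumFields.BalabanUV.Beta.D1BFx.GluonLocalDipSum

/-!
# `BalabanUV.Beta.D1BFx.GluonLocalDipSumFlat` — road «BF-x» for binder row D1, slot (K), END row `hGrp gN`, «GN-K» (part 3b): THE TWO RANK-ONE TERMS OF
# THE `SbT ⊗ dip` WORD WITH THE FLAT END BAD (`Ga∇δp_b`, values `Φ ∝ n⁻⁴`) AND THE COULOMB END GOOD (`Ga∇ρ_b`: `P·e∕nrm`, unit differences `P′·e∕nrm²`),
# summed over the (1.22) variable on the by-parts frame: `≤ K·Φ·(e^{δR}(R+1)²·P′ + 3·e^{δR}(R+1)·P)·C₀(δ)n⁴`, both orientations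

HONEST DEPENDENCY (cell records, verbatim): «continuum YM on T⁴ ⇐ BetaPertH ∧ nine spine estimates (0/9 proved); BetaPertH ⇐ (D1) ∧ (D4) ∧
CAP+tail; G-an2-4 gates asym, D1 and NE2/3/4.»  HONEST FRAMING (cell contract, verbatim): «discharging `BetaPertH` makes Bałaban's UV stability
UNCONDITIONAL — a real constructive-QFT result; it is NOT the continuum limit and NOT the Clay problem.»  THIS MODULE DISCHARGES NOTHING of the
wall: [folklore] bookkeeping over the summed frames `LocalVertexByPartsSum.exists_SbT_outer_tsum_bound_colGood∕rowGood` (taken as HYPOTHESES with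
their `K`, `R`), part 3a `GluonLocalDipSum` (weights, scale-`n` sums), `GluonLocalDipEnds.window_read`, the owner's `NeedleProjProjRow.sum_exp_scale_le`,
leaf-04-g9's `LatticeHLSRadial.sum_pow_mul_exp_scale_le`, `NeedleColumnLetters.applyKT_eq_applyK_of_symm`.  EVERY LETTER (the end profiles `P`, `P′`, `Φ`) IS A
HYPOTHESIS; no printed statement is named, no `def`, no `def … : Prop`, nothing cited, 0 sorry.  Asserts NO bound on any table of the road.  Root-level
binders hW ∕ hR-sockets ∕ hSX-socket ∕ D1Tel ∕ D1Rep — 0 discharged; (K) NOT closed; NOT D1, NOT `BetaPertH`, NOT continuum, NOT Clay.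

ABSOLUTE RULE (cell charter, verbatim): «No internally-minted statement may enter as a cited fact. Every hypothesis is either kernel-proved in
this package or a verbatim quotation of a PUBLISHED theorem with page reference. The manuscript(s) under audit are NOT citable for their own
disputed steps — they are the thing under adjudication; programme-internal (2001/route/tribunal) claims are never citable.»

WHY (FINDING F-d1leaf03g13-1, journal 2026-08-21 ≈12:08Z; part 3a's header).  Terms `∇ρ_b ⊗ ∇δp_b` and `∇δp_b ⊗ ∇ρ_b` of `dipPiece_eq_outer`: the
Coulomb end `Ga∇ρ_b` HAS a gaining unit-difference letter (`∇ρ`'s own `nrm⁻³` letter against the leg's d1: (3,3) ↦ 2), so it is the GOOD end; the flat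
end `Ga∇δp_b` (`cF∕n⁶` through the leg: `∝ n⁻⁴`) is the BAD end and enters by values only: `Σ_w nrm²·Φ·P′E₂ = ΦP′·Σe ≍ n⁻⁶·n⁴` and
`Σ_w 3nrm·Φ·PE₁ = 3ΦP·Σe ≍ n⁻⁶·n⁴`.
* §3 [folklore] **`tsum_term_flatBad_row_le`** (colGood frame), **`tsum_term_flatBad_col_le`** (rowGood frame).
NOT HERE (honest): the word's split, the `fullSum` reading, the cell (`GluonLocalDipRow`).
Unit `b2b-balaban-beta-d1-formalise-leaf-03` (gen 13), D1 formalisation swarm, road «BF-x»; `LEAVES-BFx.md` row (N) «GN-K» (part 3b).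
-/

noncomputable section

namespace Summit.QuantumFields.BalabanUV.Beta.D1BFx.GluonLocalDipSum

open Finset
open scoped BigOperators
open Literature.MathematicalPhysics.QuantumFieldTheory.Balaban1983to89
open Literature.MathematicalPhysics.QuantumFieldTheory.Balaban1983to89.Beta
open ExpKernelCalculus (Site MKer)
open DyadicShell (Pt toReal toReal_apply)
open GradedBubbles (IsStep)
open PoissonInterior (nrm nrm_pos one_le_nrm nrm_neg supNorm supNorm_neg)
open Summit.QuantumFields.BalabanUV.Beta.TameKernelCalculus (Spr)
open Summit.QuantumFields.BalabanUV.Beta.D1BFx.PackedKernelSplit (biBubble)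
open Summit.QuantumFields.BalabanUV.Beta.D1BFx.RankOneBubble (outer applyK applyKT)
open Summit.QuantumFields.BalabanUV.Beta.D1BFx.SectorRecut (SbT)
open Summit.QuantumFields.BalabanUV.Beta.D1BFx.GluonLeg (Ga)
open Summit.QuantumFields.BalabanUV.Beta.D1BFx.NeedleColumnLetters (applyKT_eq_applyK_of_symm)
open Summit.QuantumFields.BalabanUV.Beta.D1BFx.NeedleProjProjRow (abs_weight_le_sq sum_exp_scale_le)
open Summit.QuantumFields.BalabanUV.Beta.D1BFx.LatticeHLSRadial (nrm_eq_max)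
open Summit.QuantumFields.BalabanUV.Beta.D1BFx.LatticeHLSProfiles (supNorm_dyadic)
open Summit.QuantumFields.BalabanUV.Beta.D1BFx.GluonLocalDipEnds (summable_col_mul window_read)

/-! ## §3 Flat end BAD (values `Φ`), Coulomb end GOOD (`P·e∕nrm`, unit differences `P′·e∕nrm²`) -/

section FlatBad

variable (n : ℕ) [NeZero n] (a : ℝ) {K : ℝ} {R : ℕ}

/-- [folklore] **TERM `φ ⊗ ψ` WITH THE COULOMB END IN THE COLUMN (GOOD) AND THE FLAT END IN THE ROW (BAD)** — e.g. `∇ρ_b ⊗ ∇δp_b` — on the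
column-good summed frame: `|Σ'_w w_μw_ν·biBubble Ga (SbT μ (b+w)) Ga (φ⊗ψ)| ≤ K·Φ·(e^{δR}(R+1)²·P′ + 3·e^{δR}(R+1)·P)·C₀(δ)n⁴`. -/
theorem tsum_term_flatBad_row_le (ha : 0 < a) (hK : 0 ≤ K)
    (hcol : ∀ (κ : Fin 4) (b : Pt) (A B : MKer 4 (Fin 4)) (φ ψ : Pt → Fin 4 → ℝ),
      (∀ (s : Pt) (g : Fin 4), Summable fun x : Pt => ∑ a', ψ x a' * A x s a' g) →
      ∀ (W Φ₀ Γ₀ Γ₁ W₁ : Pt → ℝ), (∀ w, 0 ≤ Φ₀ w) → (∀ w, 0 ≤ Γ₀ w) → (∀ w, 0 ≤ Γ₁ w) →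
      (∀ (w q : Pt) (g : Fin 4), DyadicShell.supNorm (q - (b + w)) ≤ R → |applyKT ψ A q g| ≤ Φ₀ w) →
      (∀ (w q : Pt) (f : Fin 4), DyadicShell.supNorm (q - (b + w)) ≤ R → |applyK B φ q f| ≤ Γ₀ w) →
      (∀ (w q : Pt) (f : Fin 4) (i : Fin 4), DyadicShell.supNorm (q - (b + w)) ≤ R →
        |applyK B φ (q + BubbleTransfer.unitVec i) f - applyK B φ q f| ≤ Γ₁ w) →
      (∀ (w a' : Pt), IsStep a' → |W (w - a') - W w| ≤ W₁ w) →
      Summable (fun w => |W w| * (Φ₀ w * Γ₁ w)) → Summable (fun w => |W w| * (Φ₀ w * Γ₀ w)) →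
      Summable (fun w => W₁ w * (Φ₀ w * Γ₀ w)) →
      Summable (fun w => W w * biBubble A (SbT κ (b + w)) B (outer φ ψ)) ∧
        |∑' w, W w * biBubble A (SbT κ (b + w)) B (outer φ ψ)| ≤ K * ∑' w, (|W w| * (Φ₀ w * Γ₁ w) + W₁ w * (Φ₀ w * Γ₀ w)))
    (hA : Spr (Ga n a)) {φ ψ : Pt → Fin 4 → ℝ} {δ P P' Φ Mψ : ℝ} (hδ : 0 < δ) (hP : 0 ≤ P) (hP' : 0 ≤ P') (hΦ : 0 ≤ Φ) (b : Pt)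
    (hψ : ∀ (x : Pt) (c : Fin 4), |ψ x c| ≤ Mψ)
    (hF : ∀ (q : Pt) (c : Fin 4), |applyK (Ga n a) ψ q c| ≤ Φ)
    (hG : ∀ (q : Pt) (c : Fin 4), |applyK (Ga n a) φ q c| ≤ P * Real.exp (-(δ / n) * supNorm (d := 4) (q - b)) / nrm (d := 4) (q - b) ^ 1)
    (hG' : ∀ (q : Pt) (c i : Fin 4), |applyK (Ga n a) φ (q + AffineAveraging.unitVec i) c - applyK (Ga n a) φ q c|
      ≤ P' * Real.exp (-(δ / n) * supNorm (d := 4) (q - b)) / nrm (d := 4) (q - b) ^ 2) (μ ν : Fin 4) :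
    Summable (fun w : Pt => toReal w μ * toReal w ν * biBubble (Ga n a) (SbT μ (b + w)) (Ga n a) (outer φ ψ)) ∧
      |∑' w : Pt, toReal w μ * toReal w ν * biBubble (Ga n a) (SbT μ (b + w)) (Ga n a) (outer φ ψ)|
        ≤ K * Φ * (Real.exp (δ * R) * ((R : ℝ) + 1) ^ 2 * P' + 3 * (Real.exp (δ * R) * ((R : ℝ) + 1) ^ 1) * P) *
          ((1 + 1296 * ((2 / δ) ^ 3 * (1 + 2 / δ))) * (n : ℝ) ^ 4) := by
  have hn1 : 1 ≤ n := NeZero.one_le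
  set c₂ : ℝ := Real.exp (δ * R) * ((R : ℝ) + 1) ^ 2 with hc₂
  set c₁ : ℝ := Real.exp (δ * R) * ((R : ℝ) + 1) ^ 1 with hc₁
  set C₀ : ℝ := (1 + 1296 * ((2 / δ) ^ 3 * (1 + 2 / δ))) * (n : ℝ) ^ 4 with hC₀
  set Γ₀ : Pt → ℝ := fun w => P * c₁ * (Real.exp (-(δ / n) * supNorm (d := 4) w) / nrm (d := 4) w ^ 1) with hΓ₀
  set Γ₁ : Pt → ℝ := fun w => P' * c₂ * (Real.exp (-(δ / n) * supNorm (d := 4) w) / nrm (d := 4) w ^ 2) with hΓ₁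
  set W : Pt → ℝ := fun w => toReal w μ * toReal w ν with hW
  set W₁ : Pt → ℝ := fun w => 3 * nrm (d := 4) w with hW₁
  have hΓ₀0 : ∀ w, 0 ≤ Γ₀ w := fun w => by have := nrm_pos (d := 4) w; rw [hΓ₀]; positivity
  have hΓ₁0 : ∀ w, 0 ≤ Γ₁ w := fun w => by have := nrm_pos (d := 4) w; rw [hΓ₁]; positivity
  have hsym : applyKT ψ (Ga n a) = applyK (Ga n a) ψ := applyKT_eq_applyK_of_symm a ha n ψ
  have hG₀ : ∀ (w q : Pt) (f : Fin 4), DyadicShell.supNorm (q - (b + w)) ≤ R → |applyK (Ga n a) φ q f| ≤ Γ₀ w := fun w q f hq =>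
    (hG q f).trans ((window_read hP hδ.le hn1 1 b w q hq).trans (le_of_eq (by simp only [hΓ₀, hc₁])))
  have hG₁ : ∀ (w q : Pt) (f : Fin 4) (i : Fin 4), DyadicShell.supNorm (q - (b + w)) ≤ R →
      |applyK (Ga n a) φ (q + BubbleTransfer.unitVec i) f - applyK (Ga n a) φ q f| ≤ Γ₁ w := fun w q f i hq =>
    (hG' q f i).trans ((window_read hP' hδ.le hn1 2 b w q hq).trans (le_of_eq (by simp only [hΓ₁, hc₂])))
  have e1 : ∀ w : Pt, nrm (d := 4) w ^ 2 * (Φ * Γ₁ w) = Φ * P' * c₂ * Real.exp (-(δ / n) * supNorm (d := 4) w) := fun w => by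
    have := nrm_pos (d := 4) w; rw [hΓ₁]; field_simp
  have e0 : ∀ w : Pt, nrm (d := 4) w ^ 2 * (Φ * Γ₀ w) = Φ * P * c₁ * (nrm (d := 4) w * Real.exp (-(δ / n) * supNorm (d := 4) w)) := fun w => by
    have := nrm_pos (d := 4) w; rw [hΓ₀]; field_simp
  have e2 : ∀ w : Pt, W₁ w * (Φ * Γ₀ w) = 3 * Φ * P * c₁ * Real.exp (-(δ / n) * supNorm (d := 4) w) := fun w => by
    have := nrm_pos (d := 4) w; rw [hΓ₀, hW₁]; field_simp
  obtain ⟨hs1, ht1⟩ := summable_tsum_exp_le n hδ (by positivity : 0 ≤ Φ * P' * c₂)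
  obtain ⟨hs2, ht2⟩ := summable_tsum_exp_le n hδ (by positivity : 0 ≤ 3 * Φ * P * c₁)
  -- `|W|·Φ·Γ₀ ≤ Φ P c₁ · nrm·e ≤ Φ P c₁ · nrm²·e`-free route: dominate by `Φ P c₁ · e · nrm⁰`? use `|W| ≤ nrm²` and `nrm·e/nrm = e·(nrm/nrm)`:
  have hle0 : ∀ w, |W w| * (Φ * Γ₀ w) ≤ Φ * P * c₁ * (nrm (d := 4) w * Real.exp (-(δ / n) * supNorm (d := 4) w)) := fun w => by
    rw [← e0 w]; exact mul_le_mul_of_nonneg_right (abs_weight_le_nrm_sq w μ ν) (mul_nonneg hΦ (hΓ₀0 w))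
  have hle1 : ∀ w, |W w| * (Φ * Γ₁ w) ≤ Φ * P' * c₂ * Real.exp (-(δ / n) * supNorm (d := 4) w) := fun w => by
    rw [← e1 w]; exact mul_le_mul_of_nonneg_right (abs_weight_le_nrm_sq w μ ν) (mul_nonneg hΦ (hΓ₁0 w))
  -- `nrm·e` at scale `n` is summable: `nrm·e^{−(δ∕n)‖w‖} ≤ (2n∕δ)… ` — use `nrm ≤ nrm²`-free domination by the damped first moment
  have hS0 : Summable (fun w => |W w| * (Φ * Γ₀ w)) := by
    -- `|W|·Φ·Γ₀ ≤ ΦPc₁·nrm·e ≤ ΦPc₁·(1 + ‖w‖∞)·e`: the scale-`n` zeroth and first damped moments are summable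
    have hmom := LatticeHLSRadial.sum_pow_mul_exp_scale_le (d := 4) (by norm_num) hδ hn1 1
    obtain ⟨hse, -⟩ := summable_tsum_exp_le n hδ (by positivity : 0 ≤ Φ * P * c₁)
    have hsm : Summable (fun w : Pt => ((supNorm (d := 4) (w - 0) : ℕ) : ℝ) ^ 1 * Real.exp (-(δ / n) * supNorm (d := 4) (w - 0))) :=
      summable_of_sum_le (fun w => by positivity) fun S => hmom S 0
    refine Summable.of_nonneg_of_le (fun w => mul_nonneg (abs_nonneg _) (mul_nonneg hΦ (hΓ₀0 w))) (fun w => (hle0 w).trans ?_)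
      (hse.add (hsm.mul_left (Φ * P * c₁)))
    have hnrm : nrm (d := 4) w ≤ 1 + ((supNorm (d := 4) (w - 0) : ℕ) : ℝ) ^ 1 := by
      rw [sub_zero, pow_one, nrm_eq_max]
      exact max_le (by have : (0:ℝ) ≤ supNorm (d := 4) w := Nat.cast_nonneg _; linarith) (by linarith)
    have hex : 0 ≤ Real.exp (-(δ / n) * supNorm (d := 4) w) := (Real.exp_pos _).le
    have hc : 0 ≤ Φ * P * c₁ := by positivity
    calc Φ * P * c₁ * (nrm (d := 4) w * Real.exp (-(δ / n) * supNorm (d := 4) w))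
        ≤ Φ * P * c₁ * ((1 + ((supNorm (d := 4) (w - 0) : ℕ) : ℝ) ^ 1) * Real.exp (-(δ / n) * supNorm (d := 4) w)) :=
          mul_le_mul_of_nonneg_left (mul_le_mul_of_nonneg_right hnrm hex) hc
      _ = Φ * P * c₁ * Real.exp (-(δ / n) * supNorm (d := 4) w)
          + Φ * P * c₁ * (((supNorm (d := 4) (w - 0) : ℕ) : ℝ) ^ 1 * Real.exp (-(δ / n) * supNorm (d := 4) (w - 0))) := by
          rw [sub_zero]; ring
  have hS1 : Summable (fun w => |W w| * (Φ * Γ₁ w)) :=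
    Summable.of_nonneg_of_le (fun w => mul_nonneg (abs_nonneg _) (mul_nonneg hΦ (hΓ₁0 w))) hle1 hs1
  have hS2 : Summable (fun w => W₁ w * (Φ * Γ₀ w)) := by simp_rw [e2]; exact hs2
  obtain ⟨hs, hb⟩ := hcol μ b (Ga n a) (Ga n a) φ ψ (fun s g => summable_col_mul hA hψ s g) W (fun _ => Φ) Γ₀ Γ₁ W₁
    (fun _ => hΦ) hΓ₀0 hΓ₁0 (fun w q g _ => by rw [hsym]; exact hF q g) hG₀ hG₁
    (fun w a' ha' => by rw [hW]; exact abs_weight_step_le μ ν w a' ha') hS1 hS0 hS2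
  refine ⟨hs, hb.trans ?_⟩
  rw [hS1.tsum_add hS2]
  have h1 : ∑' w, |W w| * (Φ * Γ₁ w) ≤ Φ * P' * c₂ * C₀ := (hS1.tsum_le_tsum hle1 hs1).trans ht1
  have h2 : ∑' w, W₁ w * (Φ * Γ₀ w) ≤ 3 * Φ * P * c₁ * C₀ := by simp_rw [e2]; exact ht2
  calc K * (∑' w, |W w| * (Φ * Γ₁ w) + ∑' w, W₁ w * (Φ * Γ₀ w)) ≤ K * (Φ * P' * c₂ * C₀ + 3 * Φ * P * c₁ * C₀) :=
        mul_le_mul_of_nonneg_left (add_le_add h1 h2) hK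
    _ = K * Φ * (c₂ * P' + 3 * c₁ * P) * C₀ := by ring

/-- [folklore] **TERM `φ ⊗ ψ` WITH THE FLAT END IN THE COLUMN (BAD) AND THE COULOMB END IN THE ROW (GOOD)** — e.g. `∇δp_b ⊗ ∇ρ_b` — on the
row-good summed frame: the same bound `K·Φ·(e^{δR}(R+1)²·P′ + 3·e^{δR}(R+1)·P)·C₀(δ)n⁴`. -/
theorem tsum_term_flatBad_col_le (ha : 0 < a) (hK : 0 ≤ K)
    (hrow : ∀ (κ : Fin 4) (b : Pt) (A B : MKer 4 (Fin 4)) (φ ψ : Pt → Fin 4 → ℝ),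
      (∀ (s : Pt) (g : Fin 4), Summable fun x : Pt => ∑ a', ψ x a' * A x s a' g) →
      ∀ (W Φ₀ Φ₁ Γ₀ W₁ : Pt → ℝ), (∀ w, 0 ≤ Φ₀ w) → (∀ w, 0 ≤ Φ₁ w) → (∀ w, 0 ≤ Γ₀ w) →
      (∀ (w q : Pt) (g : Fin 4), DyadicShell.supNorm (q - (b + w)) ≤ R → |applyKT ψ A q g| ≤ Φ₀ w) →
      (∀ (w q : Pt) (g : Fin 4) (i : Fin 4), DyadicShell.supNorm (q - (b + w)) ≤ R →
        |applyKT ψ A (q + BubbleTransfer.unitVec i) g - applyKT ψ A q g| ≤ Φ₁ w) →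
      (∀ (w q : Pt) (f : Fin 4), DyadicShell.supNorm (q - (b + w)) ≤ R → |applyK B φ q f| ≤ Γ₀ w) →
      (∀ (w a' : Pt), IsStep a' → |W (w - a') - W w| ≤ W₁ w) →
      Summable (fun w => |W w| * (Γ₀ w * Φ₁ w)) → Summable (fun w => |W w| * (Γ₀ w * Φ₀ w)) →
      Summable (fun w => W₁ w * (Γ₀ w * Φ₀ w)) →
      Summable (fun w => W w * biBubble A (SbT κ (b + w)) B (outer φ ψ)) ∧
        |∑' w, W w * biBubble A (SbT κ (b + w)) B (outer φ ψ)| ≤ K * ∑' w, (|W w| * (Γ₀ w * Φ₁ w) + W₁ w * (Γ₀ w * Φ₀ w)))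
    (hA : Spr (Ga n a)) {φ ψ : Pt → Fin 4 → ℝ} {δ P P' Φ Mψ : ℝ} (hδ : 0 < δ) (hP : 0 ≤ P) (hP' : 0 ≤ P') (hΦ : 0 ≤ Φ) (b : Pt)
    (hψ : ∀ (x : Pt) (c : Fin 4), |ψ x c| ≤ Mψ)
    (hG : ∀ (q : Pt) (c : Fin 4), |applyK (Ga n a) φ q c| ≤ Φ)
    (hF : ∀ (q : Pt) (c : Fin 4), |applyK (Ga n a) ψ q c| ≤ P * Real.exp (-(δ / n) * supNorm (d := 4) (q - b)) / nrm (d := 4) (q - b) ^ 1)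
    (hF' : ∀ (q : Pt) (c i : Fin 4), |applyK (Ga n a) ψ (q + AffineAveraging.unitVec i) c - applyK (Ga n a) ψ q c|
      ≤ P' * Real.exp (-(δ / n) * supNorm (d := 4) (q - b)) / nrm (d := 4) (q - b) ^ 2) (μ ν : Fin 4) :
    Summable (fun w : Pt => toReal w μ * toReal w ν * biBubble (Ga n a) (SbT μ (b + w)) (Ga n a) (outer φ ψ)) ∧
      |∑' w : Pt, toReal w μ * toReal w ν * biBubble (Ga n a) (SbT μ (b + w)) (Ga n a) (outer φ ψ)|
        ≤ K * Φ * (Real.exp (δ * R) * ((R : ℝ) + 1) ^ 2 * P' + 3 * (Real.exp (δ * R) * ((R : ℝ) + 1) ^ 1) * P) *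
          ((1 + 1296 * ((2 / δ) ^ 3 * (1 + 2 / δ))) * (n : ℝ) ^ 4) := by
  have hn1 : 1 ≤ n := NeZero.one_le
  set c₂ : ℝ := Real.exp (δ * R) * ((R : ℝ) + 1) ^ 2 with hc₂
  set c₁ : ℝ := Real.exp (δ * R) * ((R : ℝ) + 1) ^ 1 with hc₁
  set C₀ : ℝ := (1 + 1296 * ((2 / δ) ^ 3 * (1 + 2 / δ))) * (n : ℝ) ^ 4 with hC₀
  set Φ₀ : Pt → ℝ := fun w => P * c₁ * (Real.exp (-(δ / n) * supNorm (d := 4) w) / nrm (d := 4) w ^ 1) with hΦ₀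
  set Φ₁ : Pt → ℝ := fun w => P' * c₂ * (Real.exp (-(δ / n) * supNorm (d := 4) w) / nrm (d := 4) w ^ 2) with hΦ₁
  set W : Pt → ℝ := fun w => toReal w μ * toReal w ν with hW
  set W₁ : Pt → ℝ := fun w => 3 * nrm (d := 4) w with hW₁
  have hΦ₀0 : ∀ w, 0 ≤ Φ₀ w := fun w => by have := nrm_pos (d := 4) w; rw [hΦ₀]; positivity
  have hΦ₁0 : ∀ w, 0 ≤ Φ₁ w := fun w => by have := nrm_pos (d := 4) w; rw [hΦ₁]; positivity
  have hsym : applyKT ψ (Ga n a) = applyK (Ga n a) ψ := applyKT_eq_applyK_of_symm a ha n ψ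
  have hF₀ : ∀ (w q : Pt) (g : Fin 4), DyadicShell.supNorm (q - (b + w)) ≤ R → |applyKT ψ (Ga n a) q g| ≤ Φ₀ w := fun w q g hq => by
    rw [hsym]; exact (hF q g).trans ((window_read hP hδ.le hn1 1 b w q hq).trans (le_of_eq (by simp only [hΦ₀, hc₁])))
  have hF₁ : ∀ (w q : Pt) (g : Fin 4) (i : Fin 4), DyadicShell.supNorm (q - (b + w)) ≤ R →
      |applyKT ψ (Ga n a) (q + BubbleTransfer.unitVec i) g - applyKT ψ (Ga n a) q g| ≤ Φ₁ w := fun w q g i hq => by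
    rw [hsym]; exact (hF' q g i).trans ((window_read hP' hδ.le hn1 2 b w q hq).trans (le_of_eq (by simp only [hΦ₁, hc₂])))
  have e1 : ∀ w : Pt, nrm (d := 4) w ^ 2 * (Φ * Φ₁ w) = Φ * P' * c₂ * Real.exp (-(δ / n) * supNorm (d := 4) w) := fun w => by
    have := nrm_pos (d := 4) w; rw [hΦ₁]; field_simp
  have e0 : ∀ w : Pt, nrm (d := 4) w ^ 2 * (Φ * Φ₀ w) = Φ * P * c₁ * (nrm (d := 4) w * Real.exp (-(δ / n) * supNorm (d := 4) w)) := fun w => by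
    have := nrm_pos (d := 4) w; rw [hΦ₀]; field_simp
  have e2 : ∀ w : Pt, W₁ w * (Φ * Φ₀ w) = 3 * Φ * P * c₁ * Real.exp (-(δ / n) * supNorm (d := 4) w) := fun w => by
    have := nrm_pos (d := 4) w; rw [hΦ₀, hW₁]; field_simp
  obtain ⟨hs1, ht1⟩ := summable_tsum_exp_le n hδ (by positivity : 0 ≤ Φ * P' * c₂)
  obtain ⟨hs2, ht2⟩ := summable_tsum_exp_le n hδ (by positivity : 0 ≤ 3 * Φ * P * c₁)
  have hle0 : ∀ w, |W w| * (Φ * Φ₀ w) ≤ Φ * P * c₁ * (nrm (d := 4) w * Real.exp (-(δ / n) * supNorm (d := 4) w)) := fun w => by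
    rw [← e0 w]; exact mul_le_mul_of_nonneg_right (abs_weight_le_nrm_sq w μ ν) (mul_nonneg hΦ (hΦ₀0 w))
  have hle1 : ∀ w, |W w| * (Φ * Φ₁ w) ≤ Φ * P' * c₂ * Real.exp (-(δ / n) * supNorm (d := 4) w) := fun w => by
    rw [← e1 w]; exact mul_le_mul_of_nonneg_right (abs_weight_le_nrm_sq w μ ν) (mul_nonneg hΦ (hΦ₁0 w))
  have hS0 : Summable (fun w => |W w| * (Φ * Φ₀ w)) := by
    have hmom := LatticeHLSRadial.sum_pow_mul_exp_scale_le (d := 4) (by norm_num) hδ hn1 1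
    obtain ⟨hse, -⟩ := summable_tsum_exp_le n hδ (by positivity : 0 ≤ Φ * P * c₁)
    have hsm : Summable (fun w : Pt => ((supNorm (d := 4) (w - 0) : ℕ) : ℝ) ^ 1 * Real.exp (-(δ / n) * supNorm (d := 4) (w - 0))) :=
      summable_of_sum_le (fun w => by positivity) fun S => hmom S 0
    refine Summable.of_nonneg_of_le (fun w => mul_nonneg (abs_nonneg _) (mul_nonneg hΦ (hΦ₀0 w))) (fun w => (hle0 w).trans ?_)
      (hse.add (hsm.mul_left (Φ * P * c₁)))
    have hnrm : nrm (d := 4) w ≤ 1 + ((supNorm (d := 4) (w - 0) : ℕ) : ℝ) ^ 1 := by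
      rw [sub_zero, pow_one, nrm_eq_max]
      exact max_le (by have : (0:ℝ) ≤ supNorm (d := 4) w := Nat.cast_nonneg _; linarith) (by linarith)
    have hex : 0 ≤ Real.exp (-(δ / n) * supNorm (d := 4) w) := (Real.exp_pos _).le
    have hc : 0 ≤ Φ * P * c₁ := by positivity
    calc Φ * P * c₁ * (nrm (d := 4) w * Real.exp (-(δ / n) * supNorm (d := 4) w))
        ≤ Φ * P * c₁ * ((1 + ((supNorm (d := 4) (w - 0) : ℕ) : ℝ) ^ 1) * Real.exp (-(δ / n) * supNorm (d := 4) w)) :=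
          mul_le_mul_of_nonneg_left (mul_le_mul_of_nonneg_right hnrm hex) hc
      _ = Φ * P * c₁ * Real.exp (-(δ / n) * supNorm (d := 4) w)
          + Φ * P * c₁ * (((supNorm (d := 4) (w - 0) : ℕ) : ℝ) ^ 1 * Real.exp (-(δ / n) * supNorm (d := 4) (w - 0))) := by
          rw [sub_zero]; ring
  have hS1 : Summable (fun w => |W w| * (Φ * Φ₁ w)) :=
    Summable.of_nonneg_of_le (fun w => mul_nonneg (abs_nonneg _) (mul_nonneg hΦ (hΦ₁0 w))) hle1 hs1
  have hS2 : Summable (fun w => W₁ w * (Φ * Φ₀ w)) := by simp_rw [e2]; exact hs2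
  obtain ⟨hs, hb⟩ := hrow μ b (Ga n a) (Ga n a) φ ψ (fun s g => summable_col_mul hA hψ s g) W Φ₀ Φ₁ (fun _ => Φ) W₁
    hΦ₀0 hΦ₁0 (fun _ => hΦ) hF₀ hF₁ (fun w q f _ => hG q f)
    (fun w a' ha' => by rw [hW]; exact abs_weight_step_le μ ν w a' ha') hS1 hS0 hS2
  refine ⟨hs, hb.trans ?_⟩
  rw [hS1.tsum_add hS2]
  have h1 : ∑' w, |W w| * (Φ * Φ₁ w) ≤ Φ * P' * c₂ * C₀ := (hS1.tsum_le_tsum hle1 hs1).trans ht1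
  have h2 : ∑' w, W₁ w * (Φ * Φ₀ w) ≤ 3 * Φ * P * c₁ * C₀ := by simp_rw [e2]; exact ht2
  calc K * (∑' w, |W w| * (Φ * Φ₁ w) + ∑' w, W₁ w * (Φ * Φ₀ w)) ≤ K * (Φ * P' * c₂ * C₀ + 3 * Φ * P * c₁ * C₀) :=
        mul_le_mul_of_nonneg_left (add_le_add h1 h2) hK
    _ = K * Φ * (c₂ * P' + 3 * c₁ * P) * C₀ := by ring

end FlatBad

end Summit.QuantumFields.BalabanUV.Beta.D1BFx.GluonLocalDipSum

end
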